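import Literature.NumberTheory.DiophantineGeometry.GenEllThm21
import Mathlib.Analysis.Normed.Module.FiniteDimension
import Mathlib.Topology.MetricSpace.Ultra.Basic
import Mathlib.NumberTheory.Padics.ProperSpace
import HarnessLib

/-!
# The annulus compactly bounded subset of `ℙ¹ ∖ {0,1,∞}` and the cusp-avoiding half of
# [GenEll] Thm. 2.1 (ii) ⇒ (i)

S. Mochizuki, *Arithmetic elliptic curves in general position*, Math. J. Okayama Univ. 52 (2010)
[cite: MochizukiGenEll2010] (kurims manuscript, Feb. 2009): Ex. 1.3 (ii) pp. 5–6 (compactly bounded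
subsets), Thm. 2.1 p. 11 and its proof p. 12, read on the page. The proof of (ii) ⇒ (i) (p. 12)
treats the points of bounded degree through "the compactness of the set of rational points of `X`
over any finite extension of `ℚ_v` for `v ∈ V`": points all of whose conjugates stay in a compact
region of `U_X` are covered by the hypothesis (ii) DIRECTLY, and only the points with a conjugate
near a cusp need the noncritical Belyi map. For `(X, D) = (ℙ¹_ℚ, [0]+[1]+[∞])` (the tree's
`GenEllProjLine` setting) this file builds the compactly bounded subset that does the direct part:

* `CBData.annArc ρ ⊆ ℂ` — the regular closed hull (closure of the interior) of
  `{ρ ≤ |z| ≤ ρ⁻¹, ρ ≤ |z − 1|}`: a nonempty conjugation-stable compact DOMAIN inside `ℂ ∖ {0,1}`,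
  containing every `z` with `ρ < |z| < ρ⁻¹`, `ρ < |z − 1|` (`mem_annArc_of_lt`);
* `CBData.annNon p ρ ⊆ Q̄_p` — `{ρ ≤ ‖y‖ ≤ ρ⁻¹, ρ ≤ ‖y − 1‖}`: nonempty (`1/2` lies in it for
  `ρ ≤ 1/2`), `Gal(Q̄_p/ℚ_p)`-stable, clopen, meeting every finite `K/ℚ_p` in a compact domain;
* `CBData.annulus S hS ρ hρ h2` — the compactly bounded subset `K_V` with support `{∞} ∪ S` and
  these bounding domains, for every finite set `S` of primes and `0 < ρ ≤ 1/2`;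
* `NFPoint.FarFromCusps S ρ P` — "every conjugate of `x` at `∞` (resp. at `p ∈ S`) is `ρ`-far from
  the three cusps", and `farFromCusps_mem_toSet` : such points lie in `K_V`;
* `vojtaIneq_farFromCusps_of_abcCompactlyBounded` — **statement (ii) of [GenEll] Thm. 2.1 for `Σ = S`
  implies the Vojta inequality `ht ≲ (1+ε)(log-diff + log-cond)` on the set of points of degree
  `≤ d` that are `ρ`-far from the cusps at `∞` and at the primes of `S`**, for every `d`, `ε > 0`,
  `0 < ρ ≤ 1/2` (PROVED; theorems only consume the typed predicates of `GenEllThm21`).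

What is NOT here: the points with a conjugate near a cusp (the noncritical-Belyi half of the
printed proof). No named facts; definitions are the three sets/structures above.
-/

noncomputable section

open NumberField Metric

namespace Literature.NumberTheory.DiophantineGeometry.GenEll

namespace CBData

/-! ## The archimedean annulus domain -/

/-- The closed region `{z ∈ ℂ : ρ ≤ |z| ≤ ρ⁻¹, ρ ≤ |z − 1|}` — the complement in the closed disc of
radius `ρ⁻¹` of the open `ρ`-neighbourhoods of the cusps `0` and `1`.
[cite: MochizukiGenEll2010, Ex 1.3 (ii) p.5] -/
def annArc₀ (ρ : ℝ) : Set ℂ := {z | ρ ≤ ‖z‖ ∧ ‖z‖ ≤ ρ⁻¹ ∧ ρ ≤ ‖z - 1‖}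

/-- The open region `{z ∈ ℂ : ρ < |z| < ρ⁻¹, ρ < |z − 1|}`. [cite: MochizukiGenEll2010, Ex 1.3 (ii) p.5] -/
def annArcOpen (ρ : ℝ) : Set ℂ := {z | ρ < ‖z‖ ∧ ‖z‖ < ρ⁻¹ ∧ ρ < ‖z - 1‖}

/-- The archimedean bounding domain of the annulus example: the closure of the interior of
`{ρ ≤ |z| ≤ ρ⁻¹, ρ ≤ |z − 1|}` (a compact domain by construction).
[cite: MochizukiGenEll2010, Ex 1.3 (ii) p.5] -/
def annArc (ρ : ℝ) : Set ℂ := closure (interior (annArc₀ ρ))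

/-- `annArc₀ ρ` is closed. [folklore] -/
private theorem isClosed_annArc₀ (ρ : ℝ) : IsClosed (annArc₀ ρ) := by
  have h1 : IsClosed {z : ℂ | ρ ≤ ‖z‖} := isClosed_le continuous_const continuous_norm
  have h2 : IsClosed {z : ℂ | ‖z‖ ≤ ρ⁻¹} := isClosed_le continuous_norm continuous_const
  have h3 : IsClosed {z : ℂ | ρ ≤ ‖z - 1‖} :=
    isClosed_le continuous_const ((continuous_id.sub continuous_const).norm)
  have : annArc₀ ρ = {z : ℂ | ρ ≤ ‖z‖} ∩ ({z : ℂ | ‖z‖ ≤ ρ⁻¹} ∩ {z : ℂ | ρ ≤ ‖z - 1‖}) := by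
    ext z; simp [annArc₀]
  rw [this]
  exact h1.inter (h2.inter h3)

/-- `annArcOpen ρ` is open. [folklore] -/
private theorem isOpen_annArcOpen (ρ : ℝ) : IsOpen (annArcOpen ρ) := by
  have h1 : IsOpen {z : ℂ | ρ < ‖z‖} := isOpen_lt continuous_const continuous_norm
  have h2 : IsOpen {z : ℂ | ‖z‖ < ρ⁻¹} := isOpen_lt continuous_norm continuous_const
  have h3 : IsOpen {z : ℂ | ρ < ‖z - 1‖} :=
    isOpen_lt continuous_const ((continuous_id.sub continuous_const).norm)
  have : annArcOpen ρ = {z : ℂ | ρ < ‖z‖} ∩ ({z : ℂ | ‖z‖ < ρ⁻¹} ∩ {z : ℂ | ρ < ‖z - 1‖}) := by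
    ext z; simp [annArcOpen]
  rw [this]
  exact h1.inter (h2.inter h3)

/-- The open region lies in the closed one. [folklore] -/
private theorem annArcOpen_subset_annArc₀ (ρ : ℝ) : annArcOpen ρ ⊆ annArc₀ ρ :=
  fun _ ⟨h1, h2, h3⟩ => ⟨h1.le, h2.le, h3.le⟩

/-- The open region lies in the interior of the closed one. [folklore] -/
private theorem annArcOpen_subset_interior (ρ : ℝ) : annArcOpen ρ ⊆ interior (annArc₀ ρ) :=
  (isOpen_annArcOpen ρ).subset_interior_iff.mpr (annArcOpen_subset_annArc₀ ρ)

/-- `annArc ρ ⊆ annArc₀ ρ`: a point of the archimedean annulus domain satisfies `ρ ≤ |z| ≤ ρ⁻¹`,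
`ρ ≤ |z − 1|`. [cite: MochizukiGenEll2010, Ex 1.3 (ii) p.5] -/
theorem annArc_subset_annArc₀ (ρ : ℝ) : annArc ρ ⊆ annArc₀ ρ :=
  calc annArc ρ ⊆ closure (annArc₀ ρ) := closure_mono interior_subset
    _ = annArc₀ ρ := (isClosed_annArc₀ ρ).closure_eq

/-- **Membership criterion**: a complex number with `ρ < |z| < ρ⁻¹` and `ρ < |z − 1|` lies in the
archimedean annulus domain. [cite: MochizukiGenEll2010, Ex 1.3 (ii) p.5] -/
theorem mem_annArc_of_lt {ρ : ℝ} {z : ℂ} (h1 : ρ < ‖z‖) (h2 : ‖z‖ < ρ⁻¹) (h3 : ρ < ‖z - 1‖) :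
    z ∈ annArc ρ :=
  subset_closure (annArcOpen_subset_interior ρ ⟨h1, h2, h3⟩)

/-- `annArc ρ` is compact (closed and inside the closed disc of radius `ρ⁻¹`) — the printed
condition "compact" on `K_∞`. [cite: MochizukiGenEll2010, Ex 1.3 (ii) p.5] -/
theorem isCompact_annArc (ρ : ℝ) : IsCompact (annArc ρ) := by
  refine (isCompact_closedBall (0 : ℂ) ρ⁻¹).of_isClosed_subset isClosed_closure ?_
  intro z hz
  have hz' := annArc_subset_annArc₀ ρ hz
  rw [mem_closedBall, dist_zero_right]
  exact hz'.2.1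

/-- `annArc ρ` is a compact DOMAIN (the printed condition on `K_∞`): the operation
`A ↦ closure (interior A)` is idempotent. [cite: MochizukiGenEll2010, Ex 1.3 (ii) p.5] -/
theorem closure_interior_annArc (ρ : ℝ) : closure (interior (annArc ρ)) = annArc ρ := by
  apply le_antisymm
  · calc closure (interior (annArc ρ)) ⊆ closure (annArc ρ) := closure_mono interior_subset
      _ = annArc ρ := isClosed_closure.closure_eq
  · have : interior (annArc₀ ρ) ⊆ interior (annArc ρ) :=
      isOpen_interior.subset_interior_iff.mpr subset_closure
    exact closure_mono this

/-- `−1` lies in the open region for `0 < ρ < 1`. [folklore] -/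
private theorem neg_one_mem_annArcOpen {ρ : ℝ} (h0 : 0 < ρ) (h1 : ρ < 1) : (-1 : ℂ) ∈ annArcOpen ρ := by
  refine ⟨by simpa using h1, ?_, ?_⟩
  · rw [norm_neg, norm_one]
    exact one_lt_inv_iff₀.mpr ⟨h0, h1⟩
  · have : (-1 : ℂ) - 1 = -2 := by norm_num
    rw [this, norm_neg]
    have h2 : ‖(2 : ℂ)‖ = 2 := by simp
    rw [h2]
    linarith

/-- `annArc ρ` is nonempty for `0 < ρ < 1` (the printed condition "nonempty" on `K_∞`). [cite: MochizukiGenEll2010, Ex 1.3 (ii) p.5] -/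
theorem annArc_nonempty {ρ : ℝ} (h0 : 0 < ρ) (h1 : ρ < 1) : (annArc ρ).Nonempty :=
  ⟨-1, subset_closure (annArcOpen_subset_interior ρ (neg_one_mem_annArcOpen h0 h1))⟩

/-- Complex conjugation preserves `annArc₀ ρ`. [folklore] -/
private theorem image_conj_annArc₀ (ρ : ℝ) :
    Complex.conjCLE.toHomeomorph '' annArc₀ ρ = annArc₀ ρ := by
  have key : ∀ z : ℂ, z ∈ annArc₀ ρ → (starRingEnd ℂ) z ∈ annArc₀ ρ := by
    intro z hz
    have e1 : ‖(starRingEnd ℂ) z‖ = ‖z‖ := RCLike.norm_conj z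
    have e2 : ‖(starRingEnd ℂ) z - 1‖ = ‖z - 1‖ := by
      rw [show (starRingEnd ℂ) z - 1 = (starRingEnd ℂ) (z - 1) by rw [map_sub, map_one],
        RCLike.norm_conj]
    simp only [annArc₀, Set.mem_setOf_eq] at hz ⊢
    rw [e1, e2]
    exact hz
  ext w
  simp only [Set.mem_image, ContinuousLinearEquiv.coe_toHomeomorph, Complex.conjCLE_apply]
  constructor
  · rintro ⟨z, hz, rfl⟩
    exact key z hz
  · intro hw
    refine ⟨(starRingEnd ℂ) w, key w hw, ?_⟩
    exact Complex.conj_conj w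

/-- `annArc ρ` is stable under complex conjugation `ι_X`. [cite: MochizukiGenEll2010, Ex 1.3 (ii) p.5] -/
theorem conj_mem_annArc {ρ : ℝ} {z : ℂ} (hz : z ∈ annArc ρ) : (starRingEnd ℂ) z ∈ annArc ρ := by
  have h : (starRingEnd ℂ) z ∈ Complex.conjCLE.toHomeomorph '' annArc ρ :=
    ⟨z, hz, by simp⟩
  rwa [annArc, Homeomorph.image_closure, Homeomorph.image_interior, image_conj_annArc₀] at h

/-- `annArc ρ ⊆ ℂ ∖ {0, 1}` for `ρ > 0`. [cite: MochizukiGenEll2010, Ex 1.3 (ii) p.5] -/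
theorem annArc_subset {ρ : ℝ} (h0 : 0 < ρ) : annArc ρ ⊆ {z | z ≠ 0 ∧ z ≠ 1} := by
  intro z hz
  obtain ⟨h1, -, h3⟩ := annArc_subset_annArc₀ ρ hz
  constructor
  · rintro rfl
    rw [norm_zero] at h1
    exact absurd h1 (not_le.mpr h0)
  · rintro rfl
    rw [sub_self, norm_zero] at h3
    exact absurd h3 (not_le.mpr h0)

/-! ## The nonarchimedean annulus domains -/

/-- The nonarchimedean bounding domain `{y ∈ Q̄_p : ρ ≤ ‖y‖ ≤ ρ⁻¹, ρ ≤ ‖y − 1‖}`, written as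
`closedBall 0 ρ⁻¹ ∩ (ball 0 ρ)ᶜ ∩ (ball 1 ρ)ᶜ` (each piece is clopen in the ultrametric `Q̄_p`).
[cite: MochizukiGenEll2010, Ex 1.3 (ii) p.5] -/
def annNon (p : ℕ) [Fact p.Prime] (ρ : ℝ) : Set (PadicAlgCl p) :=
  closedBall (0 : PadicAlgCl p) ρ⁻¹ ∩ (ball (0 : PadicAlgCl p) ρ)ᶜ ∩ (ball (1 : PadicAlgCl p) ρ)ᶜ

/-- Membership in `annNon p ρ`: `ρ ≤ ‖y‖ ≤ ρ⁻¹` and `ρ ≤ ‖y − 1‖`. [cite: MochizukiGenEll2010, Ex 1.3 (ii) p.5] -/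
theorem mem_annNon_iff (p : ℕ) [Fact p.Prime] (ρ : ℝ) (y : PadicAlgCl p) :
    y ∈ annNon p ρ ↔ ρ ≤ ‖y‖ ∧ ‖y‖ ≤ ρ⁻¹ ∧ ρ ≤ ‖y - 1‖ := by
  simp only [annNon, Set.mem_inter_iff, mem_closedBall, Set.mem_compl_iff, mem_ball, dist_eq_norm,
    sub_zero, not_lt]
  tauto

/-- `annNon p ρ` is clopen in `Q̄_p` (`ρ ≠ 0`). [cite: MochizukiGenEll2010, Ex 1.3 (ii) p.5] -/
theorem isClopen_annNon (p : ℕ) [Fact p.Prime] {ρ : ℝ} (hρ : ρ ≠ 0) : IsClopen (annNon p ρ) :=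
  ((IsUltrametricDist.isClopen_closedBall (0 : PadicAlgCl p) (inv_ne_zero hρ)).inter
    (IsUltrametricDist.isClopen_ball (0 : PadicAlgCl p) ρ).compl).inter
    (IsUltrametricDist.isClopen_ball (1 : PadicAlgCl p) ρ).compl

/-- `annNon p ρ ⊆ Q̄_p ∖ {0, 1}` for `ρ > 0`. [cite: MochizukiGenEll2010, Ex 1.3 (ii) p.5] -/
theorem annNon_subset (p : ℕ) [Fact p.Prime] {ρ : ℝ} (h0 : 0 < ρ) :
    annNon p ρ ⊆ {y | y ≠ 0 ∧ y ≠ 1} := by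
  intro y hy
  rw [mem_annNon_iff] at hy
  obtain ⟨h1, -, h3⟩ := hy
  constructor
  · rintro rfl
    rw [norm_zero] at h1
    exact absurd h1 (not_le.mpr h0)
  · rintro rfl
    rw [sub_self, norm_zero] at h3
    exact absurd h3 (not_le.mpr h0)

/-- The spectral norm on `Q̄_p` is `Gal(Q̄_p/ℚ_p)`-invariant (Mathlib `spectralNorm_eq_of_equiv`),
so `annNon p ρ` is `Gal(Q̄_p/ℚ_p)`-stable (the printed condition on `K_p`). [cite: MochizukiGenEll2010, Ex 1.3 (ii) p.5] -/
theorem annNon_galois (p : ℕ) [Fact p.Prime] (ρ : ℝ)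
    (σ : PadicAlgCl p ≃ₐ[ℚ_[p]] PadicAlgCl p) (y : PadicAlgCl p) (hy : y ∈ annNon p ρ) :
    σ y ∈ annNon p ρ := by
  rw [mem_annNon_iff] at hy ⊢
  have e1 : ‖σ y‖ = ‖y‖ := by
    rw [← PadicAlgCl.spectralNorm_eq, ← spectralNorm_eq_of_equiv σ, PadicAlgCl.spectralNorm_eq]
  have e2 : ‖σ y - 1‖ = ‖y - 1‖ := by
    rw [show σ y - 1 = σ (y - 1) by rw [map_sub, map_one], ← PadicAlgCl.spectralNorm_eq,
      ← spectralNorm_eq_of_equiv σ, PadicAlgCl.spectralNorm_eq]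
  rw [e1, e2]
  exact hy

/-- `1/2 ≤ ‖2‖ ≤ 1` in `ℚ_p`: `‖2‖_p = (p^{v_p(2)})⁻¹` and `p^{v_p(2)} ∣ 2`. [folklore] -/
private theorem half_le_norm_two (p : ℕ) [Fact p.Prime] :
    (1 / 2 : ℝ) ≤ ‖(2 : ℚ_[p])‖ ∧ ‖(2 : ℚ_[p])‖ ≤ 1 := by
  have hp : p.Prime := Fact.out
  refine ⟨?_, by simpa using Padic.norm_int_le_one (p := p) 2⟩
  have h2 : ((2 : ℚ) : ℚ_[p]) = 2 := by norm_num
  rw [← h2, Padic.eq_padicNorm, padicNorm.eq_zpow_of_nonzero (by norm_num : (2 : ℚ) ≠ 0)]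
  have hv : padicValRat p 2 = (padicValNat p 2 : ℤ) := by
    rw [show (2 : ℚ) = ((2 : ℕ) : ℚ) by norm_num, padicValRat.of_nat]
  rw [hv, zpow_neg, zpow_natCast]
  push_cast
  have hdvd : p ^ padicValNat p 2 ∣ 2 := pow_padicValNat_dvd
  have hle : (p : ℝ) ^ padicValNat p 2 ≤ 2 := by
    exact_mod_cast Nat.le_of_dvd two_pos hdvd
  have hpos : (0 : ℝ) < (p : ℝ) ^ padicValNat p 2 := by
    have : (0 : ℝ) < p := by exact_mod_cast hp.pos
    positivity
  rw [one_div]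
  exact inv_anti₀ hpos hle

/-- `1/2` lies in `annNon p ρ` whenever `0 < ρ ≤ 1/2` (for every `p`: `1 ≤ ‖1/2‖_p ≤ 2` and
`‖1/2 − 1‖_p = ‖1/2‖_p`), so `K_p` is nonempty (printed condition). [cite: MochizukiGenEll2010, Ex 1.3 (ii) p.5] -/
theorem half_mem_annNon (p : ℕ) [Fact p.Prime] {ρ : ℝ} (h0 : 0 < ρ) (h2 : ρ ≤ 1 / 2) :
    (2 : PadicAlgCl p)⁻¹ ∈ annNon p ρ := by
  obtain ⟨hlo, hhi⟩ := half_le_norm_two p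
  have hcast : (2 : PadicAlgCl p) = ((2 : ℚ_[p]) : PadicAlgCl p) :=
    (map_ofNat (algebraMap ℚ_[p] (PadicAlgCl p)) 2).symm
  have hn2 : ‖(2 : PadicAlgCl p)‖ = ‖(2 : ℚ_[p])‖ := by rw [hcast, PadicAlgCl.norm_extends]
  have hn : ‖(2 : PadicAlgCl p)⁻¹‖ = ‖(2 : ℚ_[p])‖⁻¹ := by rw [norm_inv, hn2]
  have hsub : (2 : PadicAlgCl p)⁻¹ - 1 = -(2 : PadicAlgCl p)⁻¹ := by norm_num
  rw [mem_annNon_iff, hsub, norm_neg, hn]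
  have hpos : (0 : ℝ) < ‖(2 : ℚ_[p])‖ := lt_of_lt_of_le (by norm_num) hlo
  have hge1 : (1 : ℝ) ≤ ‖(2 : ℚ_[p])‖⁻¹ := one_le_inv_iff₀.mpr ⟨hpos, hhi⟩
  have hle2 : ‖(2 : ℚ_[p])‖⁻¹ ≤ 2 := by
    calc ‖(2 : ℚ_[p])‖⁻¹ ≤ (1 / 2 : ℝ)⁻¹ := inv_anti₀ (by norm_num) hlo
      _ = 2 := by norm_num
  have hρ1 : ρ ≤ 1 := h2.trans (by norm_num)
  have hρinv : (2 : ℝ) ≤ ρ⁻¹ := by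
    calc (2 : ℝ) = (1 / 2 : ℝ)⁻¹ := by norm_num
      _ ≤ ρ⁻¹ := inv_anti₀ h0 h2
  exact ⟨hρ1.trans hge1, hle2.trans hρinv, hρ1.trans hge1⟩

/-- In a finite extension `K/ℚ_p` inside `Q̄_p` the trace of `annNon p ρ` is a compact domain (the
printed condition on `K_p`): it is clopen (preimage of a clopen set) and contained in a closed ball of
the finite-dimensional, hence proper, normed `ℚ_p`-space `K`. [cite: MochizukiGenEll2010, Ex 1.3 (ii) p.5] -/
theorem annNon_compactDomain (p : ℕ) [Fact p.Prime] {ρ : ℝ} (hρ : ρ ≠ 0)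
    (K : IntermediateField ℚ_[p] (PadicAlgCl p)) (hK : FiniteDimensional ℚ_[p] K) :
    IsCompact {y : K | (y : PadicAlgCl p) ∈ annNon p ρ} ∧
      closure (interior {y : K | (y : PadicAlgCl p) ∈ annNon p ρ}) =
        {y : K | (y : PadicAlgCl p) ∈ annNon p ρ} := by
  have hclopen : IsClopen {y : K | (y : PadicAlgCl p) ∈ annNon p ρ} :=
    (isClopen_annNon p hρ).preimage continuous_subtype_val
  refine ⟨?_, ?_⟩
  · -- transport from the submodule `K'`, a finite-dimensional (hence proper) normed `ℚ_p`-space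
    let K' : Submodule ℚ_[p] (PadicAlgCl p) := K.toSubalgebra.toSubmodule
    haveI : FiniteDimensional ℚ_[p] K' := hK
    haveI : ProperSpace K' := FiniteDimensional.proper ℚ_[p] K'
    have hK'cpt : IsCompact {y : K' | (y : PadicAlgCl p) ∈ annNon p ρ} := by
      refine Metric.isCompact_of_isClosed_isBounded ?_ ?_
      · exact ((isClopen_annNon p hρ).preimage continuous_subtype_val).isClosed
      · refine (Metric.isBounded_closedBall (x := (0 : K')) (r := ρ⁻¹)).subset ?_
        intro y hy
        have hy' := ((mem_annNon_iff p ρ _).mp hy).2.1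
        rw [mem_closedBall, dist_zero_right]
        exact hy'
    have himg : {y : K | (y : PadicAlgCl p) ∈ annNon p ρ} =
        (fun y : K' => (⟨(y : PadicAlgCl p), y.2⟩ : K)) '' {y : K' | (y : PadicAlgCl p) ∈ annNon p ρ} := by
      ext y
      simp only [Set.mem_setOf_eq, Set.mem_image]
      constructor
      · intro hy
        exact ⟨⟨(y : PadicAlgCl p), y.2⟩, hy, rfl⟩
      · rintro ⟨z, hz, rfl⟩
        exact hz
    rw [himg]
    exact hK'cpt.image (Continuous.subtype_mk continuous_subtype_val _)
  · rw [hclopen.isOpen.interior_eq, hclopen.isClosed.closure_eq]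

/-! ## The annulus compactly bounded subset -/

/-- **The annulus compactly bounded subset with support `{∞} ∪ S`** (`S` any finite set of primes,
`0 < ρ ≤ 1/2`): `K_∞ = annArc ρ`, `K_p = annNon p ρ` — the points all of whose conjugates are
`ρ`-far from the cusps `0, 1, ∞` at `∞` and at every `p ∈ S`. [cite: MochizukiGenEll2010, Ex 1.3 (ii) p.5] -/
def annulus (S : Finset ℕ) (hS : ∀ p ∈ S, p.Prime) (ρ : ℝ) (h0 : 0 < ρ) (h2 : ρ ≤ 1 / 2) :
    CBData where
  primes := S
  primes_prime := hS
  Karc := annArc ρ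
  Knon := fun p _ => annNon p ρ
  Karc_nonempty := annArc_nonempty h0 (lt_of_le_of_lt h2 (by norm_num))
  Karc_isCompact := isCompact_annArc ρ
  Karc_closure_interior := closure_interior_annArc ρ
  Karc_conj := fun _ hz => conj_mem_annArc hz
  Karc_subset := annArc_subset h0
  Knon_nonempty := fun p _ _ => ⟨_, half_mem_annNon p h0 h2⟩
  Knon_galois := fun p _ _ σ y hy => annNon_galois p ρ σ y hy
  Knon_compactDomain := fun p _ _ K hK => annNon_compactDomain p h0.ne' K hK
  Knon_subset := fun p _ _ => annNon_subset p h0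

/-- The support of the annulus subset is exactly `{∞} ∪ S`. [cite: MochizukiGenEll2010, Thm 2.1 (ii) p.11] -/
theorem annulus_supportContains (S : Finset ℕ) (hS : ∀ p ∈ S, p.Prime) (ρ : ℝ) (h0 : 0 < ρ)
    (h2 : ρ ≤ 1 / 2) : (annulus S hS ρ h0 h2).SupportContains S :=
  subset_rfl

end CBData

/-! ## Points far from the cusps -/

namespace NFPoint

/-- "`x` is `ρ`-far from the cusps at `∞` and at the primes of `S`": every complex conjugate `σ(x)`
satisfies `ρ < |σ(x)| < ρ⁻¹`, `ρ < |σ(x) − 1|`, and every `Q̄_p`-conjugate, `p ∈ S`, satisfies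
`ρ ≤ ‖σ(x)‖ ≤ ρ⁻¹`, `ρ ≤ ‖σ(x) − 1‖` — i.e. "the set of `[F:ℚ]` points … determined by `x`" stays
out of the `ρ`-neighbourhoods of `0, 1, ∞` ([GenEll] Ex. 1.3 (ii) p. 6, proof of Thm. 2.1 p. 12).
[cite: MochizukiGenEll2010, Thm 2.1 p.12] -/
def FarFromCusps (S : Finset ℕ) (ρ : ℝ) (P : NFPoint) : Prop :=
  (∀ σ : P.F →+* ℂ, ρ < ‖σ P.x‖ ∧ ‖σ P.x‖ < ρ⁻¹ ∧ ρ < ‖σ P.x - 1‖) ∧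
    ∀ p ∈ S, ∀ [Fact p.Prime], ∀ σ : P.F →+* PadicAlgCl p,
      ρ ≤ ‖σ P.x‖ ∧ ‖σ P.x‖ ≤ ρ⁻¹ ∧ ρ ≤ ‖σ P.x - 1‖

/-- A point `ρ`-far from the cusps lies in the annulus compactly bounded subset.
[cite: MochizukiGenEll2010, Ex 1.3 (ii) p.6] -/
theorem farFromCusps_mem_toSet {S : Finset ℕ} (hS : ∀ p ∈ S, p.Prime) {ρ : ℝ} (h0 : 0 < ρ)
    (h2 : ρ ≤ 1 / 2) {P : NFPoint} (hP : P.FarFromCusps S ρ) :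
    P ∈ (CBData.annulus S hS ρ h0 h2).toSet := by
  refine ⟨fun σ => ?_, fun p hp _ σ => ?_⟩
  · obtain ⟨h1, h2', h3⟩ := hP.1 σ
    exact CBData.mem_annArc_of_lt h1 h2' h3
  · obtain ⟨h1, h2', h3⟩ := hP.2 p hp σ
    exact (CBData.mem_annNon_iff p ρ _).mpr ⟨h1, h2', h3⟩

end NFPoint

/-- The set of points `ρ`-far from the cusps is contained in the annulus compactly bounded subset.
[cite: MochizukiGenEll2010, Thm 2.1 p.12] -/
theorem setOf_farFromCusps_subset_toSet {S : Finset ℕ} (hS : ∀ p ∈ S, p.Prime) {ρ : ℝ}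
    (h0 : 0 < ρ) (h2 : ρ ≤ 1 / 2) :
    {P : NFPoint | P.FarFromCusps S ρ} ⊆ (CBData.annulus S hS ρ h0 h2).toSet :=
  fun _ hP => NFPoint.farFromCusps_mem_toSet hS h0 h2 hP

/-- **The cusp-avoiding half of [GenEll] Thm. 2.1 (ii) ⇒ (i) for `ℙ¹ ∖ {0,1,∞}`**: if statement
(ii) holds for the finite set of primes `Σ = S`, then for every `d`, every `ε > 0` and every
`0 < ρ ≤ 1/2` the inequality of BD-classes `ht_{ω_P(C)} ≲ (1+ε)(log-diff_P + log-cond_C)` holds on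
the set of points of `U_P(Q̄)^{≤d}` that are `ρ`-far from the cusps at `∞` and at the primes of
`S` — these points form (part of) one compactly bounded subset, the annulus, to which (ii) applies
directly ("the compactness of the set of rational points … over any finite extension of `ℚ_v`",
p. 12). PROVED. [cite: MochizukiGenEll2010, Thm 2.1 p.12] -/
theorem vojtaIneq_farFromCusps_of_abcCompactlyBounded {S : Finset ℕ} (hS : ∀ p ∈ S, p.Prime)
    (h : ABCCompactlyBounded S) {d : ℕ} (hd : 0 < d) {ε : ℝ} (hε : 0 < ε) {ρ : ℝ} (h0 : 0 < ρ)
    (h2 : ρ ≤ 1 / 2) : VojtaIneq {P : NFPoint | P.FarFromCusps S ρ} d ε :=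
  (h d hd ε hε (CBData.annulus S hS ρ h0 h2) (CBData.annulus_supportContains S hS ρ h0 h2)).mono
    (Set.inter_subset_inter_left _ (setOf_farFromCusps_subset_toSet hS h0 h2))

/-- The `Σ = {2}` instance consumed by the route item `GenEllTwo`: under
`ABCCompactlyBounded {2}`, Vojta holds in every degree `d` on the points `ρ`-far from the cusps at
`∞` and at `2`. [cite: MochizukiGenEll2010, Thm 2.1 p.12] -/
theorem vojtaIneq_farFromCusps_two (h : ABCCompactlyBounded ({2} : Finset ℕ)) {d : ℕ} (hd : 0 < d)
    {ε : ℝ} (hε : 0 < ε) {ρ : ℝ} (h0 : 0 < ρ) (h2 : ρ ≤ 1 / 2) :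
    VojtaIneq {P : NFPoint | P.FarFromCusps ({2} : Finset ℕ) ρ} d ε :=
  vojtaIneq_farFromCusps_of_abcCompactlyBounded
    (fun p hp => by rw [Finset.mem_singleton] at hp; subst hp; exact Nat.prime_two) h hd hε h0 h2

end Literature.NumberTheory.DiophantineGeometry.GenEll

end
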